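import Summits.QuantumFields.YangMills.Theorems.BalabanUVNodesN27AtRecord13CoPHHomeOn
import Summits.QuantumFields.YangMills.Theorems.BalabanUVNodesN14AtRateRecord13CoPHOn

/-!
# BalabanUVNodes ∕ N27 = binder B5 AT THE RECORD — XXXIXᶜᵒᵖᴴ's REGIME-HOME KNIT WITH THE N14 SLOT IN dag-n14's CURRENCIES (trigger (t2) of this seat: a producer face in a NEW currency
# at the v1.7 `CoPH` homes): `S_N14 (RRec₁₃CoPHOn 𝔯 Rg)` is REPLACED by (a) NE1′'s θ-level form «`N14At (𝔯.ne1 F θ hP g₀ os)` at every admissible Stage-13H tuple with provisos in the regime»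
# and (b) the END-B UNIFORM-LEAVES form «some `U : UniformConstants` with `U.Λ` the carriers' rate and `BookingLeaves U …` for the reading's dressed tower at every such tuple» — ONE
# application each of dag-n14-c's `YMDAG.N14.s_N14_rRec₁₃CoPHOn_of_n14At` ∕ `…_of_uniformLeaves` ∕ `…_unityNondeg_of_n14At` (`…N14AtRateRecord13CoPHOn`, p543529 ✓; dag-n14-a's
# `n14At_of_uniformLeaves` = `dressedStabilityStrict_of_bookingLeaves` underneath) composed with XXXIXᶜᵒᵖᴴ `spine_rec13CCoPHOn_of_homes₁₃CoPHOn` ∕ `spine_rec13CCoPHN_of_homes₁₃CoPHOn` (p544545 ✓)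
# (cell `pub-ymgap`, HUMAN RULING D-0062 Track A, R134 seat `pub-ymgap-dag-n27-c` (s2) gen 8; K3⁷ `SpineGivenEndpointR13SepCoPH` = stmt-QuantumFields-20544, `--kind proof --supports 20544 --as helper`;
# COUNT-NEUTRAL; `N`-generic, NO Theses import — the item-facing face is ONE application of leaf B `spineGivenEndpointR13SepCoPH_of_homes₁₃CoPHCN` at `N = 2` at the call site)

WHAT IS KERNEL-CHECKED ([bookkeeping]; 0 `def`, 0 `sorry`):
* `spine_rec13CCoPHOn_of_homes₁₃CoPHOn_n14At` — B5 `Spine` at RR-2's regime record class `Node00.IsRecordOfRecord₁₃CCoPHOn F N Rg` from: NE1′ in its θ-level form at the reading's dressed-tower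
  assignment `𝔯.ne1`, the other five K4 stubs at `RRec₁₃CoPHOn 𝔯 Rg`, N20 ∕ N21 at `SRec₁₃CoPHOn cr Rg`, the guarded keyed extraction clause and the same-tuple N19′ edge;
* `spine_rec13CCoPHOn_of_homes₁₃CoPHOn_uniformLeaves` — the same with NE1′ supplied by END-B uniform leaves (`∃ U, U.Λ = (𝔯.ne1 …).Λ ∧ ∀ p K, Nonempty (BookingLeaves U …)`);
* `spine_rec13CCoPHN_of_homes₁₃CoPHOn_n14At` ∕ `…_uniformLeaves` — the two at the guard of record `Rg := Node00.unityNondeg₁₃H N` (print's partition of unity `θ.ZhUnity F N` and non-degenerate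
  present slots), landing in RR-2's CN class `Node00.IsRecordOfRecord₁₃CCoPHN F N` — at `N = 2` one application of leaf B short of K3⁷.

HONEST FRAMING.  COMPOSITE-node bookkeeping: every K4∕K5 stub, the extraction clause, the edge AND the N14 antecedent (`N14At` ∕ uniform leaves for NODE O's dressed tower of record — no producer
of either at any reading today) are HYPOTHESES (0∕1); the readings `cr`, `𝔯` are PARAMETERS; NE1′ is a cell paraphrase of [Balaban1989LargeFieldII] (1.64)–(1.67), NOT proved; nothing of
Bałaban's asserted; NE7 ∕ NE7b ∕ NE7c NOT PRINTED for d = 4 and NOT PROVED; N14 and N27 NOT discharged; K3⁷ NOT claimed; no `Provisos₁₃CoPH` inhabitant claimed (K0⁷ open); counts UNMOVED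
(typed 28∕28 · discharged 5∕27, A 5∕28); one finite four-torus programme at fixed `ε` — NOT ℝ⁴, NOT infinite volume, NOT OS, NOT a mass gap, NOT Clay.  No decl below carries a cite tag.
-/

namespace Summit.QuantumFields.YangMills.Theorems.BalabanUVNodesN27SpineRecord

open Literature.MathematicalPhysics.QuantumFieldTheory.Balaban1983to89
open Literature.MathematicalPhysics.QuantumFieldTheory.Balaban1983to89.T4Continuum
open T4ContinuumYM4Torus (ForSmallCouplings)
open Summit.QuantumFields.BalabanUV.T4Continuum.Spine
open Summit.QuantumFields.BalabanUV.T4Continuum.NE1p.DressedRoot (UniformConstants BookingLeaves)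
open YMDAG.UVSplit
open YMDAG.N14 (s_N14_rRec₁₃CoPHOn_of_n14At s_N14_rRec₁₃CoPHOn_of_uniformLeaves)
open Node00 (Stage13HParams datumOfRecord₁₃CoPH)

variable {N : ℕ} [NeZero N] (cr : SpineReading₁₃CoPH N) (𝔯 : RateReading₁₃CoPH N) (Rg : (F : T4Family) → Stage13HParams F N → Prop)

/-! ## §1 The regime-home knit with N14 in NE1′'s θ-level currency ∕ in the END-B uniform-leaves currency -/

/-- **N27 = B5 AT THE REGIME RECORD CLASS, N14 READ AS NE1′ AT THE READING'S DRESSED TOWER**: XXXIXᶜᵒᵖᴴ `spine_rec13CCoPHOn_of_homes₁₃CoPHOn` with its first hypothesis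
`S_N14 (RRec₁₃CoPHOn 𝔯 Rg)` supplied by dag-n14-c's knit `s_N14_rRec₁₃CoPHOn_of_n14At` from «`N14At (𝔯.ne1 F θ hP g₀ os)` at every admissible tuple with provisos in the regime».
Every hypothesis 0∕1 today. [bookkeeping] -/
theorem spine_rec13CCoPHOn_of_homes₁₃CoPHOn_n14At
    (h14 : ∀ (F : T4Family) (θ : Stage13HParams F N) (hP : θ.Provisos₁₃CoPH F N), Rg F θ → θ.Admissible F N →
      ∀ (g₀ : ℕ → ℝ) (os : List (ULoop F)), N14At (𝔯.ne1 F θ hP g₀ os))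
    (h15 : S_N15 (RRec₁₃CoPHOn 𝔯 Rg)) (h16 : S_N16 (RRec₁₃CoPHOn 𝔯 Rg)) (h17 : S_N17 (RRec₁₃CoPHOn 𝔯 Rg))
    (h18 : S_N18 (RRec₁₃CoPHOn 𝔯 Rg)) (h22 : S_N22 (RRec₁₃CoPHOn 𝔯 Rg)) (h20 : S_N20 (SRec₁₃CoPHOn cr Rg)) (h21 : S_N21 (SRec₁₃CoPHOn cr Rg))
    (hx : ∀ (F : T4Family) (θ : Stage13HParams F N) (hP : θ.Provisos₁₃CoPH F N), Rg F θ → θ.Admissible F N →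
      B16.EndStatementBPrinted (datumOfRecord₁₃CoPH F N θ hP).C → DagBinding.EndpointExistence (datumOfRecord₁₃CoPH F N θ hP).C.toB12 →
        ForSmallCouplings (datumOfRecord₁₃CoPH F N θ hP) fun g₀ => ∀ os : List (ULoop F),
          0 < (cr F θ hP g₀ os).l₀ ∧ 0 < (cr F θ hP g₀ os).vol ∧
          (∀ (K : ℕ) (t : ℝ), |t| ≤ (cr F θ hP g₀ os).l₀ →
            T4GenFunBounds.schemeZ ((datumOfRecord₁₃CoPH F N θ hP).scheme g₀) os ((cr F θ hP g₀ os).K₀ + K) t =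
              ∑ τ ∈ (cr F θ hP g₀ os).T K, (cr F θ hP g₀ os).A K t τ) ∧
          (∀ (K : ℕ) (t : ℝ), |t| ≤ (cr F θ hP g₀ os).l₀ →
            T4GenFunBounds.schemeZ ((datumOfRecord₁₃CoPH F N θ hP).scheme g₀) os ((cr F θ hP g₀ os).K₀ + K + 1) t =
              ∑ τ ∈ (cr F θ hP g₀ os).T K, (cr F θ hP g₀ os).B K t τ))
    (h19 : ∀ (F : T4Family) (θ : Stage13HParams F N) (hP : θ.Provisos₁₃CoPH F N), Rg F θ → θ.Admissible F N → ∀ (g₀ : ℕ → ℝ) (os : List (ULoop F)),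
      (∀ k : ℕ, RatesAt (datumOfRecord₁₃CoPH F N θ hP) (rateCarriersOfRecord₁₃CoPH 𝔯 F θ hP g₀ os k)) → letI := (cr F θ hP g₀ os).dec
        ∃ δ : ℕ → ℝ, NE7.Core (cr F θ hP g₀ os).l₀ (cr F θ hP g₀ os).vol (cr F θ hP g₀ os).T (cr F θ hP g₀ os).Bad
          (fun K t τ => (cr F θ hP g₀ os).A K t τ - (cr F θ hP g₀ os).shA K t τ) (fun K t τ => (cr F θ hP g₀ os).B K t τ - (cr F θ hP g₀ os).shB K t τ) δ ∧
          Summable δ) :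
    Spine (N := N) fun F D w => Node00.IsRecordOfRecord₁₃CCoPHOn F N Rg D w :=
  spine_rec13CCoPHOn_of_homes₁₃CoPHOn cr 𝔯 Rg (s_N14_rRec₁₃CoPHOn_of_n14At 𝔯 Rg h14) h15 h16 h17 h18 h22 h20 h21 hx h19

/-- **N27 = B5 AT THE REGIME RECORD CLASS, N14 FROM END-B UNIFORM LEAVES**: the same knit with `S_N14 (RRec₁₃CoPHOn 𝔯 Rg)` supplied by dag-n14-c's
`s_N14_rRec₁₃CoPHOn_of_uniformLeaves` — at every admissible tuple with provisos in the regime SOME `U : UniformConstants` with `U.Λ` the dressed tower's rate and END-B booking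
leaves for it (dag-n14-a's `n14At_of_uniformLeaves` underneath).  Every hypothesis 0∕1 today. [bookkeeping] -/
theorem spine_rec13CCoPHOn_of_homes₁₃CoPHOn_uniformLeaves
    (h14 : ∀ (F : T4Family) (θ : Stage13HParams F N) (hP : θ.Provisos₁₃CoPH F N), Rg F θ → θ.Admissible F N → ∀ (g₀ : ℕ → ℝ) (os : List (ULoop F)),
      ∃ U : UniformConstants, U.Λ = (𝔯.ne1 F θ hP g₀ os).Λ ∧
        ∀ p K, Nonempty (BookingLeaves U ((𝔯.ne1 F θ hP g₀ os).𝒯.B p K) ((𝔯.ne1 F θ hP g₀ os).𝒯.T p K)))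
    (h15 : S_N15 (RRec₁₃CoPHOn 𝔯 Rg)) (h16 : S_N16 (RRec₁₃CoPHOn 𝔯 Rg)) (h17 : S_N17 (RRec₁₃CoPHOn 𝔯 Rg))
    (h18 : S_N18 (RRec₁₃CoPHOn 𝔯 Rg)) (h22 : S_N22 (RRec₁₃CoPHOn 𝔯 Rg)) (h20 : S_N20 (SRec₁₃CoPHOn cr Rg)) (h21 : S_N21 (SRec₁₃CoPHOn cr Rg))
    (hx : ∀ (F : T4Family) (θ : Stage13HParams F N) (hP : θ.Provisos₁₃CoPH F N), Rg F θ → θ.Admissible F N →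
      B16.EndStatementBPrinted (datumOfRecord₁₃CoPH F N θ hP).C → DagBinding.EndpointExistence (datumOfRecord₁₃CoPH F N θ hP).C.toB12 →
        ForSmallCouplings (datumOfRecord₁₃CoPH F N θ hP) fun g₀ => ∀ os : List (ULoop F),
          0 < (cr F θ hP g₀ os).l₀ ∧ 0 < (cr F θ hP g₀ os).vol ∧
          (∀ (K : ℕ) (t : ℝ), |t| ≤ (cr F θ hP g₀ os).l₀ →
            T4GenFunBounds.schemeZ ((datumOfRecord₁₃CoPH F N θ hP).scheme g₀) os ((cr F θ hP g₀ os).K₀ + K) t =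
              ∑ τ ∈ (cr F θ hP g₀ os).T K, (cr F θ hP g₀ os).A K t τ) ∧
          (∀ (K : ℕ) (t : ℝ), |t| ≤ (cr F θ hP g₀ os).l₀ →
            T4GenFunBounds.schemeZ ((datumOfRecord₁₃CoPH F N θ hP).scheme g₀) os ((cr F θ hP g₀ os).K₀ + K + 1) t =
              ∑ τ ∈ (cr F θ hP g₀ os).T K, (cr F θ hP g₀ os).B K t τ))
    (h19 : ∀ (F : T4Family) (θ : Stage13HParams F N) (hP : θ.Provisos₁₃CoPH F N), Rg F θ → θ.Admissible F N → ∀ (g₀ : ℕ → ℝ) (os : List (ULoop F)),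
      (∀ k : ℕ, RatesAt (datumOfRecord₁₃CoPH F N θ hP) (rateCarriersOfRecord₁₃CoPH 𝔯 F θ hP g₀ os k)) → letI := (cr F θ hP g₀ os).dec
        ∃ δ : ℕ → ℝ, NE7.Core (cr F θ hP g₀ os).l₀ (cr F θ hP g₀ os).vol (cr F θ hP g₀ os).T (cr F θ hP g₀ os).Bad
          (fun K t τ => (cr F θ hP g₀ os).A K t τ - (cr F θ hP g₀ os).shA K t τ) (fun K t τ => (cr F θ hP g₀ os).B K t τ - (cr F θ hP g₀ os).shB K t τ) δ ∧
          Summable δ) :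
    Spine (N := N) fun F D w => Node00.IsRecordOfRecord₁₃CCoPHOn F N Rg D w :=
  spine_rec13CCoPHOn_of_homes₁₃CoPHOn cr 𝔯 Rg (s_N14_rRec₁₃CoPHOn_of_uniformLeaves 𝔯 Rg h14) h15 h16 h17 h18 h22 h20 h21 hx h19

/-! ## §2 The two at the guard of record `Rg := Node00.unityNondeg₁₃H N` (RR-2's CN class — one application of leaf B short of K3⁷ at `N = 2`) -/

/-- **N27 = B5 AT THE CN RECORD CLASS, N14 READ AS NE1′ AT THE READING'S DRESSED TOWER** — §1 at the guard of record (print's partition of unity `θ.ZhUnity F N` and non-degenerate present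
slots): NE1′'s θ-form is asked only of such tuples.  Every hypothesis 0∕1 today. [bookkeeping] -/
theorem spine_rec13CCoPHN_of_homes₁₃CoPHOn_n14At
    (h14 : ∀ (F : T4Family) (θ : Stage13HParams F N) (hP : θ.Provisos₁₃CoPH F N), (θ.ZhUnity F N ∧ θ.SlotsNondegenerate₁₃ F N) → θ.Admissible F N →
      ∀ (g₀ : ℕ → ℝ) (os : List (ULoop F)), N14At (𝔯.ne1 F θ hP g₀ os))
    (h15 : S_N15 (RRec₁₃CoPHOn 𝔯 (Node00.unityNondeg₁₃H N))) (h16 : S_N16 (RRec₁₃CoPHOn 𝔯 (Node00.unityNondeg₁₃H N)))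
    (h17 : S_N17 (RRec₁₃CoPHOn 𝔯 (Node00.unityNondeg₁₃H N))) (h18 : S_N18 (RRec₁₃CoPHOn 𝔯 (Node00.unityNondeg₁₃H N)))
    (h22 : S_N22 (RRec₁₃CoPHOn 𝔯 (Node00.unityNondeg₁₃H N))) (h20 : S_N20 (SRec₁₃CoPHOn cr (Node00.unityNondeg₁₃H N))) (h21 : S_N21 (SRec₁₃CoPHOn cr (Node00.unityNondeg₁₃H N)))
    (hx : ∀ (F : T4Family) (θ : Stage13HParams F N) (hP : θ.Provisos₁₃CoPH F N), (θ.ZhUnity F N ∧ θ.SlotsNondegenerate₁₃ F N) → θ.Admissible F N →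
      B16.EndStatementBPrinted (datumOfRecord₁₃CoPH F N θ hP).C → DagBinding.EndpointExistence (datumOfRecord₁₃CoPH F N θ hP).C.toB12 →
        ForSmallCouplings (datumOfRecord₁₃CoPH F N θ hP) fun g₀ => ∀ os : List (ULoop F),
          0 < (cr F θ hP g₀ os).l₀ ∧ 0 < (cr F θ hP g₀ os).vol ∧
          (∀ (K : ℕ) (t : ℝ), |t| ≤ (cr F θ hP g₀ os).l₀ →
            T4GenFunBounds.schemeZ ((datumOfRecord₁₃CoPH F N θ hP).scheme g₀) os ((cr F θ hP g₀ os).K₀ + K) t =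
              ∑ τ ∈ (cr F θ hP g₀ os).T K, (cr F θ hP g₀ os).A K t τ) ∧
          (∀ (K : ℕ) (t : ℝ), |t| ≤ (cr F θ hP g₀ os).l₀ →
            T4GenFunBounds.schemeZ ((datumOfRecord₁₃CoPH F N θ hP).scheme g₀) os ((cr F θ hP g₀ os).K₀ + K + 1) t =
              ∑ τ ∈ (cr F θ hP g₀ os).T K, (cr F θ hP g₀ os).B K t τ))
    (h19 : ∀ (F : T4Family) (θ : Stage13HParams F N) (hP : θ.Provisos₁₃CoPH F N), (θ.ZhUnity F N ∧ θ.SlotsNondegenerate₁₃ F N) → θ.Admissible F N →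
      ∀ (g₀ : ℕ → ℝ) (os : List (ULoop F)), (∀ k : ℕ, RatesAt (datumOfRecord₁₃CoPH F N θ hP) (rateCarriersOfRecord₁₃CoPH 𝔯 F θ hP g₀ os k)) → letI := (cr F θ hP g₀ os).dec
        ∃ δ : ℕ → ℝ, NE7.Core (cr F θ hP g₀ os).l₀ (cr F θ hP g₀ os).vol (cr F θ hP g₀ os).T (cr F θ hP g₀ os).Bad
          (fun K t τ => (cr F θ hP g₀ os).A K t τ - (cr F θ hP g₀ os).shA K t τ) (fun K t τ => (cr F θ hP g₀ os).B K t τ - (cr F θ hP g₀ os).shB K t τ) δ ∧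
          Summable δ) :
    Spine (N := N) fun F D w => Node00.IsRecordOfRecord₁₃CCoPHN F N D w :=
  spine_rec13CCoPHOn_of_homes₁₃CoPHOn_n14At cr 𝔯 (Node00.unityNondeg₁₃H N) h14 h15 h16 h17 h18 h22 h20 h21 hx h19

/-- **N27 = B5 AT THE CN RECORD CLASS, N14 FROM END-B UNIFORM LEAVES** — §1's uniform-leaves form at the guard of record.  Every hypothesis 0∕1 today. [bookkeeping] -/
theorem spine_rec13CCoPHN_of_homes₁₃CoPHOn_uniformLeaves
    (h14 : ∀ (F : T4Family) (θ : Stage13HParams F N) (hP : θ.Provisos₁₃CoPH F N), (θ.ZhUnity F N ∧ θ.SlotsNondegenerate₁₃ F N) → θ.Admissible F N →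
      ∀ (g₀ : ℕ → ℝ) (os : List (ULoop F)), ∃ U : UniformConstants, U.Λ = (𝔯.ne1 F θ hP g₀ os).Λ ∧
        ∀ p K, Nonempty (BookingLeaves U ((𝔯.ne1 F θ hP g₀ os).𝒯.B p K) ((𝔯.ne1 F θ hP g₀ os).𝒯.T p K)))
    (h15 : S_N15 (RRec₁₃CoPHOn 𝔯 (Node00.unityNondeg₁₃H N))) (h16 : S_N16 (RRec₁₃CoPHOn 𝔯 (Node00.unityNondeg₁₃H N)))
    (h17 : S_N17 (RRec₁₃CoPHOn 𝔯 (Node00.unityNondeg₁₃H N))) (h18 : S_N18 (RRec₁₃CoPHOn 𝔯 (Node00.unityNondeg₁₃H N)))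
    (h22 : S_N22 (RRec₁₃CoPHOn 𝔯 (Node00.unityNondeg₁₃H N))) (h20 : S_N20 (SRec₁₃CoPHOn cr (Node00.unityNondeg₁₃H N))) (h21 : S_N21 (SRec₁₃CoPHOn cr (Node00.unityNondeg₁₃H N)))
    (hx : ∀ (F : T4Family) (θ : Stage13HParams F N) (hP : θ.Provisos₁₃CoPH F N), (θ.ZhUnity F N ∧ θ.SlotsNondegenerate₁₃ F N) → θ.Admissible F N →
      B16.EndStatementBPrinted (datumOfRecord₁₃CoPH F N θ hP).C → DagBinding.EndpointExistence (datumOfRecord₁₃CoPH F N θ hP).C.toB12 →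
        ForSmallCouplings (datumOfRecord₁₃CoPH F N θ hP) fun g₀ => ∀ os : List (ULoop F),
          0 < (cr F θ hP g₀ os).l₀ ∧ 0 < (cr F θ hP g₀ os).vol ∧
          (∀ (K : ℕ) (t : ℝ), |t| ≤ (cr F θ hP g₀ os).l₀ →
            T4GenFunBounds.schemeZ ((datumOfRecord₁₃CoPH F N θ hP).scheme g₀) os ((cr F θ hP g₀ os).K₀ + K) t =
              ∑ τ ∈ (cr F θ hP g₀ os).T K, (cr F θ hP g₀ os).A K t τ) ∧
          (∀ (K : ℕ) (t : ℝ), |t| ≤ (cr F θ hP g₀ os).l₀ →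
            T4GenFunBounds.schemeZ ((datumOfRecord₁₃CoPH F N θ hP).scheme g₀) os ((cr F θ hP g₀ os).K₀ + K + 1) t =
              ∑ τ ∈ (cr F θ hP g₀ os).T K, (cr F θ hP g₀ os).B K t τ))
    (h19 : ∀ (F : T4Family) (θ : Stage13HParams F N) (hP : θ.Provisos₁₃CoPH F N), (θ.ZhUnity F N ∧ θ.SlotsNondegenerate₁₃ F N) → θ.Admissible F N →
      ∀ (g₀ : ℕ → ℝ) (os : List (ULoop F)), (∀ k : ℕ, RatesAt (datumOfRecord₁₃CoPH F N θ hP) (rateCarriersOfRecord₁₃CoPH 𝔯 F θ hP g₀ os k)) → letI := (cr F θ hP g₀ os).dec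
        ∃ δ : ℕ → ℝ, NE7.Core (cr F θ hP g₀ os).l₀ (cr F θ hP g₀ os).vol (cr F θ hP g₀ os).T (cr F θ hP g₀ os).Bad
          (fun K t τ => (cr F θ hP g₀ os).A K t τ - (cr F θ hP g₀ os).shA K t τ) (fun K t τ => (cr F θ hP g₀ os).B K t τ - (cr F θ hP g₀ os).shB K t τ) δ ∧
          Summable δ) :
    Spine (N := N) fun F D w => Node00.IsRecordOfRecord₁₃CCoPHN F N D w :=
  spine_rec13CCoPHOn_of_homes₁₃CoPHOn_uniformLeaves cr 𝔯 (Node00.unityNondeg₁₃H N) h14 h15 h16 h17 h18 h22 h20 h21 hx h19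

end Summit.QuantumFields.YangMills.Theorems.BalabanUVNodesN27SpineRecord
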